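import Mathlib
import HarnessLib
import Literature.MathematicalPhysics.StatisticalMechanics.StepKernelBoundsABKM
import Literature.MathematicalPhysics.StatisticalMechanics.FlowRepresentation

/-!
# The weights `w_k^Λ` are integrable against the tail measures `μ_{k+1} ∗ ⋯ ∗ μ_{N+1}` — the Fubini
# hypothesis of the iterated representation (4.11)–(4.12) of [ABKM19]

`FlowRepresentation.integral_flow_eq` iterates Proposition 6.6 through the scales and needs, at each
step `k < N`, the integrability of `(ξ, φ) ↦ F_k(ξ + φ)` for the product of the step measure `μ_{k+1}`
with the tail measure `μ_{k+2} ∗ ⋯ ∗ μ_{N+1}`.  Along the renormalisation-group flow `|F_k| ≤ C_k w_k^Λ`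
(weak/strong weights, `FlowStepIntegrability`), so it suffices that the top weight `w_k^Λ` be integrable
for these measures.  This follows from the integration property (w7) of Theorem 7.1 — here in the form
`StepKernelBounds.integral_stepMeasure_le` for a family of step kernels by predicate — and the
comparisons `w_{k:k+1}^X ≤ w_{k:k+1}^{X*} ≤ w_{k+1}^X` (Lemma 7.2, (7.5)), by downward induction from
the last scale:

* `midWeight_le_weight_succ` — `w_{k:k+1}^X ≤ w_{k+1}^X` when `X ⊆ X*`;
* `integrable_weight_univ_prod_of_integrable` — one step: integrability of `w_{k+1}^Λ` for `ν` gives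
  integrability of `(ξ,φ) ↦ w_k^Λ(ξ+φ)` for `μ_{k+1} ⊗ ν`;
* **`integrable_weight_univ_tailMeasure`** — `w_k^Λ ∈ L¹(tailMeasure 𝒞s N (N−k))` for `k ≤ N`, and
  **`integrable_weight_univ_prod_tailMeasure`** — the product form consumed by `integral_flow_eq`;
* `integrable_prod_of_norm_le_weight` — transfer to any continuous `F` with `‖F‖ ≤ C w_k^Λ`.

Everything is proved; no named fact.

## References
* S. Adams, S. Buchholz, R. Kotecký, S. Müller, arXiv:1910.13564, Theorem 7.1 (w7), Lemma 7.2 (7.23),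
  Ch. 7.1 (7.5), Ch. 4.2 (4.11)–(4.12) [AdamsBuchholzKoteckyMuller2019].
-/

noncomputable section

namespace Literature.MathematicalPhysics.StatisticalMechanics.GradientRG

open scoped BigOperators Classical ENNReal
open Finset Matrix MeasureTheory
open Literature.MathematicalPhysics.StatisticalMechanics.TorusPolymer (IsPolymer numBlocks isPolymer_univ)

variable {d M : ℕ} [NeZero M]

namespace WeightData

/-- **`w_{k:k+1}^X ≤ w_{k+1}^X`** for dominated monotone data with `X ⊆ X*`.
[cite: AdamsBuchholzKoteckyMuller2019, Ch. 7.1 (7.5) / Lemma 7.5 (iv)] -/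
theorem midWeight_le_weight_succ {Λ : Type*} [Fintype Λ] [DecidableEq Λ] (W : WeightData Λ)
    {D : ℕ → Matrix Λ Λ ℝ} (hD : W.Dominated D) (hm : W.Monotone) (hsub : ∀ k X, X ⊆ W.enl k X)
    (k : ℕ) (X : Finset Λ) (φ : Λ → ℝ) : W.midWeight k X φ ≤ W.weight (k + 1) X φ :=
  (midWeight_mono hD hm k (hsub (k + 1) X) φ).trans (midWeight_enl_le_weight_succ hD k X φ)

end WeightData

/-- The weights are continuous in the field. [cite: AdamsBuchholzKoteckyMuller2019, Ch. 7.1 (7.4)] -/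
theorem continuous_weight (W : WeightData (Fin d → ZMod M)) (k : ℕ) (X : Finset (Fin d → ZMod M)) :
    Continuous fun φ : (Fin d → ZMod M) → ℝ => W.weight k X φ := by
  have h := continuous_weight_comp_add W k X 0
  simpa using h

section Tail

variable {W : WeightData (Fin d → ZMod M)} {L N : ℕ} {A𝒫 C₂ : ℝ} {𝒞s : ℕ → (Fin d → ZMod M) → ℝ}
  {D : ℕ → Matrix (Fin d → ZMod M) (Fin d → ZMod M) ℝ}

/-- **One step down**: if `w_{k+1}^Λ ∈ L¹(ν)` then `(ξ, φ) ↦ w_k^Λ(ξ + φ) ∈ L¹(μ_{k+1} ⊗ ν)`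
((w7) for the step kernel, then `w_{k:k+1}^Λ ≤ w_{k+1}^Λ`).
[cite: AdamsBuchholzKoteckyMuller2019, Theorem 7.1 (w7) / Ch. 4.2 (4.11)] -/
theorem integrable_weight_univ_prod_of_integrable (hD : W.Dominated D) (hm : W.Monotone)
    (hsub : ∀ k X, X ⊆ W.enl k X) {k : ℕ} (hS : StepKernelBounds W L k A𝒫 C₂ (𝒞s (k + 1)))
    {ν : Measure ((Fin d → ZMod M) → ℝ)} [SFinite ν]
    (hν : Integrable (fun φ => W.weight (k + 1) univ φ) ν) :
    Integrable (fun p : ((Fin d → ZMod M) → ℝ) × ((Fin d → ZMod M) → ℝ) => W.weight k univ (p.1 + p.2))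
      ((stepMeasure (𝒞s (k + 1))).prod ν) := by
  set μ := stepMeasure (M := M) (𝒞s (k + 1)) with hμ
  haveI : SFinite μ := by rw [hμ]; unfold stepMeasure; infer_instance
  have hcont : Continuous fun p : ((Fin d → ZMod M) → ℝ) × ((Fin d → ZMod M) → ℝ) =>
      W.weight k univ (p.1 + p.2) :=
    (continuous_weight W k univ).comp (continuous_fst.add continuous_snd)
  refine ⟨hcont.aestronglyMeasurable, ?_⟩
  -- Tonelli: integrate `ξ` first
  have hmeas : AEMeasurable (fun p : ((Fin d → ZMod M) → ℝ) × ((Fin d → ZMod M) → ℝ) =>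
      (‖W.weight k univ (p.1 + p.2)‖ₑ : ℝ≥0∞)) (μ.prod ν) :=
    hcont.measurable.enorm.aemeasurable
  unfold HasFiniteIntegral
  rw [MeasureTheory.lintegral_prod _ hmeas, MeasureTheory.lintegral_lintegral_swap hmeas]
  -- the inner integral: `∫ w_k^Λ(φ + ξ) μ_{k+1}(dξ) ≤ A𝒫^{|Λ|_k} w_{k:k+1}^Λ(φ) ≤ A𝒫^{|Λ|_k} w_{k+1}^Λ(φ)`
  set c : ℝ := A𝒫 ^ numBlocks (L ^ k) (univ : Finset (Fin d → ZMod M)) with hc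
  have hinner : ∀ φ : (Fin d → ZMod M) → ℝ,
      ∫⁻ ξ, (‖W.weight k univ (ξ + φ)‖ₑ : ℝ≥0∞) ∂μ ≤ ENNReal.ofReal (c * W.weight (k + 1) univ φ) := by
    intro φ
    have hint : Integrable (fun ξ : (Fin d → ZMod M) → ℝ => W.weight k univ (φ + ξ)) μ :=
      hS.integrable_weight hD univ φ
    have heq : ∫⁻ ξ, (‖W.weight k univ (ξ + φ)‖ₑ : ℝ≥0∞) ∂μ =
        ENNReal.ofReal (∫ ξ, W.weight k univ (φ + ξ) ∂μ) := by
      rw [MeasureTheory.ofReal_integral_eq_lintegral_ofReal hint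
        (ae_of_all _ fun ξ => (W.weight_pos k univ (φ + ξ)).le)]
      refine lintegral_congr fun ξ => ?_
      rw [add_comm, Real.enorm_eq_ofReal (W.weight_pos k univ (φ + ξ)).le]
    rw [heq]
    refine ENNReal.ofReal_le_ofReal ?_
    calc ∫ ξ, W.weight k univ (φ + ξ) ∂μ ≤ c * W.midWeight k univ φ :=
          hS.integral_stepMeasure_le (isPolymer_univ (L ^ k)) φ
      _ ≤ c * W.weight (k + 1) univ φ := by
          have hc0 : 0 ≤ c := by
            have h0 := (integral_nonneg fun ξ => (W.weight_pos k univ ((0 : (Fin d → ZMod M) → ℝ) + ξ)).le).trans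
              (hS.integral_stepMeasure_le (isPolymer_univ (L ^ k)) 0)
            exact nonneg_of_mul_nonneg_left (by rw [hc]; exact h0) (W.midWeight_pos k univ 0)
          exact mul_le_mul_of_nonneg_left (W.midWeight_le_weight_succ hD hm hsub k univ φ) hc0
  calc ∫⁻ φ, ∫⁻ ξ, (‖W.weight k univ (ξ + φ)‖ₑ : ℝ≥0∞) ∂μ ∂ν
      ≤ ∫⁻ φ, ENNReal.ofReal (c * W.weight (k + 1) univ φ) ∂ν := lintegral_mono fun φ => hinner φ
    _ = ∫⁻ φ, ENNReal.ofReal c * (‖W.weight (k + 1) univ φ‖ₑ : ℝ≥0∞) ∂ν := by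
        refine lintegral_congr fun φ => ?_
        rw [Real.enorm_eq_ofReal (W.weight_pos (k + 1) univ φ).le]
        by_cases hc0 : 0 ≤ c
        · rw [ENNReal.ofReal_mul hc0]
        · have hc1 : c * W.weight (k + 1) univ φ ≤ 0 :=
            mul_nonpos_of_nonpos_of_nonneg (le_of_not_ge hc0) (W.weight_pos (k + 1) univ φ).le
          rw [ENNReal.ofReal_of_nonpos hc1, ENNReal.ofReal_of_nonpos (le_of_not_ge hc0), zero_mul]
    _ = ENNReal.ofReal c * ∫⁻ φ, (‖W.weight (k + 1) univ φ‖ₑ : ℝ≥0∞) ∂ν := by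
        rw [lintegral_const_mul' _ _ ENNReal.ofReal_ne_top]
    _ < ⊤ := ENNReal.mul_lt_top ENNReal.ofReal_lt_top hν.2

/-- **`w_k^Λ ∈ L¹(μ_{k+1} ∗ ⋯ ∗ μ_{N+1})` for every `k ≤ N`**, for a family of step kernels with
`StepKernelBounds` at every scale `k ≤ N` (downward induction from the last scale).
[cite: AdamsBuchholzKoteckyMuller2019, Theorem 7.1 (w7) / Ch. 4.2 (4.11)–(4.12)] -/
theorem integrable_weight_univ_tailMeasure (hD : W.Dominated D) (hm : W.Monotone)
    (hsub : ∀ k X, X ⊆ W.enl k X) (hS : ∀ k, k ≤ N → StepKernelBounds W L k A𝒫 C₂ (𝒞s (k + 1))) :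
    ∀ m, m ≤ N → Integrable (fun φ => W.weight (N - m) univ φ) (tailMeasure 𝒞s N m) := by
  have h𝒞 : ∀ j, 1 ≤ j → j ≤ N + 1 → (Matrix.circulant (𝒞s j)).PosSemidef := by
    intro j hj hjN
    obtain ⟨k, rfl⟩ : ∃ k, j = k + 1 := ⟨j - 1, by omega⟩
    exact (hS k (by omega)).posSemidef
  intro m
  induction m with
  | zero =>
    intro _
    rw [Nat.sub_zero, tailMeasure, tailKernel]
    have h := (hS N le_rfl).integrable_weight hD univ 0
    simpa using h
  | succ m ih =>
    intro hm'
    have hk : N - (m + 1) + 1 = N - m := by omega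
    rw [tailMeasure_succ h𝒞 (by omega), Measure.conv]
    haveI : SFinite (tailMeasure 𝒞s N m) := by unfold tailMeasure stepMeasure; infer_instance
    have hprod := integrable_weight_univ_prod_of_integrable hD hm hsub (k := N - (m + 1))
      (ν := tailMeasure 𝒞s N m) (hS _ (by omega)) (by rw [hk]; exact ih (by omega))
    rw [hk] at hprod
    refine (integrable_map_measure ?_ (by fun_prop)).2 hprod
    exact (continuous_weight W _ univ).aestronglyMeasurable

/-- **The Fubini hypothesis of `integral_flow_eq` for the weights**: for `k < N`,
`(ξ, φ) ↦ w_k^Λ(ξ + φ) ∈ L¹(μ_{k+1} ⊗ (μ_{k+2} ∗ ⋯ ∗ μ_{N+1}))`.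
[cite: AdamsBuchholzKoteckyMuller2019, Ch. 4.2 (4.11)–(4.12)] -/
theorem integrable_weight_univ_prod_tailMeasure (hD : W.Dominated D) (hm : W.Monotone)
    (hsub : ∀ k X, X ⊆ W.enl k X) (hS : ∀ k, k ≤ N → StepKernelBounds W L k A𝒫 C₂ (𝒞s (k + 1)))
    {k : ℕ} (hk : k < N) :
    Integrable (fun p : ((Fin d → ZMod M) → ℝ) × ((Fin d → ZMod M) → ℝ) => W.weight k univ (p.1 + p.2))
      ((stepMeasure (𝒞s (k + 1))).prod (tailMeasure 𝒞s N (N - (k + 1)))) := by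
  haveI : SFinite (tailMeasure 𝒞s N (N - (k + 1))) := by unfold tailMeasure stepMeasure; infer_instance
  have h := integrable_weight_univ_tailMeasure hD hm hsub hS (N - (k + 1)) (by omega)
  rw [show N - (N - (k + 1)) = k + 1 by omega] at h
  exact integrable_weight_univ_prod_of_integrable hD hm hsub (hS k hk.le) h

/-- **Transfer to the flow functionals**: a continuous `F` with `‖F(ψ)‖ ≤ C w_k^Λ(ψ)` satisfies the
Fubini hypothesis of `integral_flow_eq` at step `k < N`.
[cite: AdamsBuchholzKoteckyMuller2019, Ch. 4.2 (4.11)–(4.12)] -/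
theorem integrable_prod_of_norm_le_weight (hD : W.Dominated D) (hm : W.Monotone)
    (hsub : ∀ k X, X ⊆ W.enl k X) (hS : ∀ k, k ≤ N → StepKernelBounds W L k A𝒫 C₂ (𝒞s (k + 1)))
    {k : ℕ} (hk : k < N) {F : ((Fin d → ZMod M) → ℝ) → ℂ} (hF : Continuous F) {C : ℝ}
    (hFC : ∀ ψ, ‖F ψ‖ ≤ C * W.weight k univ ψ) :
    Integrable (fun p : ((Fin d → ZMod M) → ℝ) × ((Fin d → ZMod M) → ℝ) => F (p.1 + p.2))
      ((stepMeasure (𝒞s (k + 1))).prod (tailMeasure 𝒞s N (N - (k + 1)))) := by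
  have hw := integrable_weight_univ_prod_tailMeasure hD hm hsub hS hk
  refine (hw.const_mul C).mono' (hF.comp (continuous_fst.add continuous_snd)).aestronglyMeasurable
    (ae_of_all _ fun p => ?_)
  exact hFC (p.1 + p.2)

end Tail

end Literature.MathematicalPhysics.StatisticalMechanics.GradientRG

end
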